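import Summits.FinalStateConjecture.FinalStateConjecture.Theorems.InertialRecession.Negative.ExpandingChargeBinary

/-!
# Negative knowledge for the crux `InertialRecession` (item stmt-FinalStateConjecture-10166), XI:
# ADDITIVITY is a load-bearing hypothesis of `stub_expandingChargeKinematics` (S4, line `old-light-leaves-the-cone`)

Refuter file (D-0016 negative lane, `--supports stmt-FinalStateConjecture-10166`), drefute seat gen 4. No Theses decl is
asserted. Main result `expandingChargeKinematics_false_without_additivity`: S4 (`ExpandingChargeKinematics`, verbatim the
registered stub by `expandingChargeKinematics_iff`) with the additivity clause deleted — single-hole identification, the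
window law and every kinematic clause kept — is FALSE, witnessed by the drifting binary of `ExpandingChargeBinary.lean`.

Mechanism of the counter-model (what additivity is for). Without additivity nothing ties the charge of a PAIR window to
its members, so the pair's bulk charge may be pinned (here to `0`) while both members drift together with the
non-convergent Cesàro mean of the witness; the only windows that see the drift are SINGLE-hole windows, whose radius is
at most `d/(2δ)` (`two_mul_delta_mul_le_norm_sub`: member within `(1−δ)R`, partner beyond `(1+δ)R` ⇒ `2δR ≤ d`), so the
window law grants them the rate `C R⁻² ≥ C(2δ)²/d² = C(2δ)²/(1 + √(1+t²)) ≍ C(2δ)²/t`, which pays for the drift's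
acceleration `|ξ''| ≤ 1/(4t)` with `C_δ = δ⁻²`, `η = 0` (`abs_vel_sub_vel_le`, `abs_kinCharge_sub_le`); identification
holds with `ζ = 2|d'| → 0` because the members' velocities differ from the drift's by `±d'/2 • e₁`
(`kinCharge_sub_binary_le`). READING for a proof of S4: (i) it is additivity that lets scale-`t` windows constrain
sublinear clusters at all; (ii) the effective per-hole coupling is read at the LARGEST admissible single-hole radius
`d/(2δ)` — `C(2δ)^{-2}d^{-2} + C(2δ)^{-7/4}d^{-7/4}` — not at `d/3`, and its constant depends on `δ`.
-/

set_option linter.dupNamespace false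

noncomputable section

namespace Summit.FinalStateConjecture.FinalStateConjecture.Theorems.InertialRecession.Negative

open Filter Set
open scoped Topology
open Literature.Geometry.Lorentzian

/-! ## §1 Window geometry, Lorentz-factor comparison, slow variation of the drift charge -/

/-- WINDOW GEOMETRY: if `x` is inside a `δ`-admissible window and `y` is outside it, the window radius is at most
`‖x − y‖/(2δ)`. [folklore] -/
lemma two_mul_delta_mul_le_norm_sub {x y c : E3} {R δ : ℝ} (hR : 0 < R) (hδ : 0 < δ)
    (hx : ‖x - c‖ ≤ (1 - δ) * R ∨ (1 + δ) * R ≤ ‖x - c‖) (hy : ‖y - c‖ ≤ (1 - δ) * R ∨ (1 + δ) * R ≤ ‖y - c‖)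
    (hin : ‖x - c‖ ≤ R) (hout : ¬ ‖y - c‖ ≤ R) : 2 * δ * R ≤ ‖x - y‖ := by
  have hx' : ‖x - c‖ ≤ (1 - δ) * R := by
    rcases hx with h | h
    · exact h
    · nlinarith
  have hy' : (1 + δ) * R ≤ ‖y - c‖ := by
    rcases hy with h | h
    · exfalso; apply hout; nlinarith
    · exact h
  have htri : ‖y - c‖ ≤ ‖x - y‖ + ‖x - c‖ := by
    calc ‖y - c‖ = ‖(x - c) - (x - y)‖ := by congr 1; abel
      _ ≤ ‖x - c‖ + ‖x - y‖ := norm_sub_le _ _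
      _ = ‖x - y‖ + ‖x - c‖ := add_comm _ _
  linarith

/-- The Lorentz factors of the two velocity fields differ by `≤ |d'|/4`: `(√B)⁻¹ − (√A)⁻¹ ≤ 2(A − B)` for
`1/2 ≤ B ≤ A ≤ 1`. [folklore] -/
lemma inv_sqrt_sub_inv_sqrt_le {A B : ℝ} (hB : 1 / 2 ≤ B) (hBA : B ≤ A) (_hA : A ≤ 1) :
    0 ≤ (√B)⁻¹ - (√A)⁻¹ ∧ (√B)⁻¹ - (√A)⁻¹ ≤ 2 * (A - B) := by
  set s := √A with hs
  set r := √B with hr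
  have hs2 : s ^ 2 = A := Real.sq_sqrt (by linarith)
  have hr2 : r ^ 2 = B := Real.sq_sqrt (by linarith)
  have hr0 : 0 ≤ r := Real.sqrt_nonneg _
  have hs0 : 0 ≤ s := Real.sqrt_nonneg _
  have hr7 : 7 / 10 ≤ r := by nlinarith
  have hrs : r ≤ s := Real.sqrt_le_sqrt hBA
  have hrp : 0 < r := by linarith
  have hsp : 0 < s := by linarith
  have hpos : 0 < r * s * (s + r) := by positivity
  have key : r⁻¹ - s⁻¹ = (A - B) / (r * s * (s + r)) := by
    rw [eq_div_iff hpos.ne']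
    field_simp
    nlinarith [hs2, hr2]
  rw [key]
  refine ⟨div_nonneg (by linarith) hpos.le, ?_⟩
  rw [div_le_iff₀ hpos]
  have hden : 1 / 2 ≤ r * s * (s + r) := by nlinarith [mul_le_mul hr7 hr7 (by norm_num) hr0]
  nlinarith

/-- Components `1, 2, 3` of the drift charge. [folklore] -/
lemma kinCharge_one_two_three (t : ℝ) :
    kinCharge t 1 = (√(1 - ‖axisVel t‖ ^ 2))⁻¹ * (vel t / 4) ∧ kinCharge t 2 = 0 ∧ kinCharge t 3 = 0 := by
  refine ⟨?_, ?_, ?_⟩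
  · rw [show (1 : Fin 4) = (0 : Fin 3).succ from rfl, kinCharge_succ, (axisVel_apply t).1]
  · rw [show (2 : Fin 4) = (1 : Fin 3).succ from rfl, kinCharge_succ, (axisVel_apply t).2.1, mul_zero]
  · rw [show (3 : Fin 4) = (2 : Fin 3).succ from rfl, kinCharge_succ, (axisVel_apply t).2.2, mul_zero]

/-- Identification error of the model: the single-hole sphere carries `kinCharge` (the charge of the drift), which differs
from the kinematic charge `γ(vᵢ)(1, vᵢ)` of hole `i` by at most `2|d'(t)| → 0`. [folklore] -/
lemma kinCharge_sub_binary_le (i : Fin 2) (t : ℝ) :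
    |kinCharge t 0 - (√(1 - ‖binaryVel i t‖ ^ 2))⁻¹| ≤ 2 * |sepAD1 t| ∧
    ∀ k : Fin 3, |kinCharge t k.succ - (√(1 - ‖binaryVel i t‖ ^ 2))⁻¹ * binaryVel i t k| ≤ 2 * |sepAD1 t| := by
  have hv2 := norm_binaryVel_sq_le i t
  have hd := abs_sepAD1_le_half t
  have hd' := abs_le.mp hd
  have hdn := abs_nonneg (sepAD1 t)
  have hvel := abs_le.mp (abs_vel_le t)
  obtain ⟨k1, k2, k3⟩ := kinCharge_one_two_three t
  -- the two Lorentz factors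
  set A := 1 - ‖axisVel t‖ ^ 2 with hA
  set B := 1 - ‖binaryVel i t‖ ^ 2 with hB
  have hAB : A - B = sepAD1 t ^ 2 / 4 := by rw [hA, hB, norm_axisVel_sq, norm_binaryVel_sq]; ring
  have hB2 : 1 / 2 ≤ B := by rw [hB]; linarith
  have hBA : B ≤ A := by nlinarith
  have hA1 : A ≤ 1 := by rw [hA]; nlinarith [norm_nonneg (axisVel t)]
  obtain ⟨hg0, hg⟩ := inv_sqrt_sub_inv_sqrt_le hB2 hBA hA1
  have hgap : (√B)⁻¹ - (√A)⁻¹ ≤ |sepAD1 t| / 4 := by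
    refine hg.trans ?_
    rw [hAB]
    have : sepAD1 t ^ 2 ≤ |sepAD1 t| * (1 / 2) := by
      rw [← sq_abs]; nlinarith
    nlinarith
  have hγB : (√B)⁻¹ ≤ 2 := by
    have h14 : (1 / 2 : ℝ) ≤ √B := by
      rw [Real.le_sqrt (by norm_num) (by linarith)]; nlinarith
    calc (√B)⁻¹ ≤ (1 / 2 : ℝ)⁻¹ := inv_anti₀ (by norm_num) h14
      _ = 2 := by norm_num
  have hγB0 : 0 ≤ (√B)⁻¹ := inv_nonneg.mpr (Real.sqrt_nonneg _)
  have hq : |vel t / 4| ≤ 1 / 4 := by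
    rw [abs_div, abs_of_pos (by norm_num : (0:ℝ) < 4)]; linarith [abs_vel_le t]
  refine ⟨?_, fun k ↦ ?_⟩
  · rw [kinCharge_zero, abs_sub_comm, abs_of_nonneg hg0]
    linarith
  · fin_cases k
    · -- drift component: `γ_A (vel/4) − γ_B (vel/4)`
      show |kinCharge t 1 - (√B)⁻¹ * binaryVel i t 0| ≤ 2 * |sepAD1 t|
      rw [k1, binaryVel_apply_zero, ← sub_mul, abs_mul, abs_sub_comm, abs_of_nonneg hg0]
      nlinarith [abs_nonneg (vel t / 4)]
    · -- separation component: `0 − γ_B (±d'/2)`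
      show |kinCharge t 2 - (√B)⁻¹ * binaryVel i t 1| ≤ 2 * |sepAD1 t|
      rw [k2, binaryVel_apply_one, zero_sub, abs_neg, abs_mul, abs_of_nonneg hγB0, abs_mul]
      have hc : |(((i : ℕ) : ℝ) - 1 / 2)| = 1 / 2 := by fin_cases i <;> norm_num
      rw [hc]
      nlinarith
    · -- third component: `0 − 0`
      show |kinCharge t 3 - (√B)⁻¹ * binaryVel i t 2| ≤ 2 * |sepAD1 t|
      rw [k3, binaryVel_apply_two, mul_zero, sub_zero, abs_zero]
      positivity

/-- The drift charge moves slowly: `|kinCharge t₂ μ − kinCharge t₁ μ| ≤ |vel t₂ − vel t₁| / 2`. [folklore] -/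
lemma abs_kinCharge_sub_le (t₁ t₂ : ℝ) (μ : Fin 4) :
    |kinCharge t₂ μ - kinCharge t₁ μ| ≤ |vel t₂ - vel t₁| / 2 := by
  have ha : |vel t₂ / 4| ≤ 1 / 4 := by
    rw [abs_div, abs_of_pos (by norm_num : (0:ℝ) < 4)]; linarith [abs_vel_le t₂]
  have hb : |vel t₁ / 4| ≤ 1 / 4 := by
    rw [abs_div, abs_of_pos (by norm_num : (0:ℝ) < 4)]; linarith [abs_vel_le t₁]
  have hq : |vel t₂ / 4 - vel t₁ / 4| = |vel t₂ - vel t₁| / 4 := by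
    rw [← sub_div, abs_div, abs_of_pos (by norm_num : (0:ℝ) < 4)]
  have hn := abs_nonneg (vel t₂ - vel t₁)
  obtain ⟨a1, a2, a3⟩ := kinCharge_one_two_three t₂
  obtain ⟨b1, b2, b3⟩ := kinCharge_one_two_three t₁
  fin_cases μ
  · show |kinCharge t₂ 0 - kinCharge t₁ 0| ≤ |vel t₂ - vel t₁| / 2
    rw [kinCharge_zero, kinCharge_zero, norm_axisVel_sq, norm_axisVel_sq]
    have := abs_lorentz_sub_le ha hb
    rw [hq] at this
    linarith
  · show |kinCharge t₂ 1 - kinCharge t₁ 1| ≤ |vel t₂ - vel t₁| / 2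
    rw [a1, b1, norm_axisVel_sq, norm_axisVel_sq]
    have := abs_lorentzMomentum_sub_le ha hb
    rw [hq] at this
    linarith
  · show |kinCharge t₂ 2 - kinCharge t₁ 2| ≤ |vel t₂ - vel t₁| / 2
    rw [a2, b2]; simp; positivity
  · show |kinCharge t₂ 3 - kinCharge t₁ 3| ≤ |vel t₂ - vel t₁| / 2
    rw [a3, b3]; simp; positivity

/-- `acc` is continuous. [folklore] -/
lemma continuous_acc : Continuous acc :=
  continuous_iff_continuousAt.mpr fun t ↦ (hasDerivAt_acc t).continuousAt

/-- The witness velocity profile has variation `≤ ∫ ds/s` on `[t₁, t₂] ⊆ [1, ∞)`. [folklore] -/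
lemma abs_vel_sub_vel_le {t₁ t₂ : ℝ} (ht₁ : 1 ≤ t₁) (h12 : t₁ ≤ t₂) :
    |vel t₂ - vel t₁| ≤ ∫ s in t₁..t₂, s⁻¹ := by
  have hftc : ∫ s in t₁..t₂, acc s = vel t₂ - vel t₁ :=
    intervalIntegral.integral_eq_sub_of_hasDerivAt (fun s _ ↦ hasDerivAt_vel s)
      (continuous_acc.intervalIntegrable _ _)
  rw [← hftc, ← Real.norm_eq_abs]
  refine intervalIntegral.norm_integral_le_of_norm_le h12 (Eventually.of_forall fun s hs ↦ ?_) ?_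
  · have hs0 : 0 < s := by linarith [hs.1]
    rw [Real.norm_eq_abs]
    exact abs_acc_le hs0
  · refine ContinuousOn.intervalIntegrable ?_
    rw [uIcc_of_le h12]
    exact continuousOn_id.inv₀ fun s hs ↦ (by linarith [hs.1] : (0 : ℝ) < s).ne'

/-- **(A) Additivity is load-bearing.** S4 with ADDITIVITY DELETED (single-hole identification kept) is false: the
drifting binary `binaryCentre` (common drift = the witness world-line, separation `d(t) = √(1 + √(1+t²)) ≍ √t` along
`e₁`) with the abstract charge `binaryCharge` (the drift's charge on windows containing exactly one hole, `0` on windows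
containing both or none). Without additivity nothing ties the charge of a PAIR window to its members, so the pair's bulk
charge is pinned (to `0`) while the members drift together; single-hole windows have radius `R ≤ d/(2δ)`
(`two_mul_delta_mul_le_norm_sub`), hence a budget rate `≥ C(2δ)²/d² ≍ 1/t` that pays for the drift's `O(1/t)`
acceleration: `C_δ = δ⁻²`, `η = 0` suffice. READING: it is additivity that lets scale-`t` windows constrain sublinear
clusters; and the effective per-hole coupling a proof may use is `C(2δ)^{-2}d^{-2} + C(2δ)^{-7/4}d^{-7/4}`, read at
the LARGEST admissible single-hole radius `d/(2δ)`, not at `d/3`. [folklore] -/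
theorem expandingChargeKinematics_false_without_additivity :
    ¬ ∀ (N : ℕ) (M : Fin N → ℝ) (ξ v : Fin N → ℝ → E3) (κ : ℝ) (P : ℝ → E3 → ℝ → Fin 4 → ℝ),
      (∀ i, 0 < M i) → 0 < κ → κ < 1 → (∀ i, ContDiff ℝ ((⊤ : ℕ∞) : WithTop ℕ∞) (ξ i)) →
      S4Cone N ξ κ → S4Separation N ξ → (∀ i, Continuous (v i)) → S4SpeedBound N v → S4Slaving N ξ v →
      S4WindowLaw N ξ κ P →
      (∃ (C R₀ T : ℝ) (ζ : ℝ → ℝ), Tendsto ζ atTop (𝓝 0) ∧ S4SingleHole N M ξ v κ P C R₀ T ζ) →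
      S4Conclusion N ξ := by
  intro h
  have hsep : S4Separation 2 binaryCentre := by
    intro i j hij
    refine tendsto_sepA_atTop.congr fun t ↦ ?_
    rw [norm_binaryCentre_sub hij]
  have hslav : S4Slaving 2 binaryCentre binaryVel := by
    intro i
    simp only [deriv_binaryCentre, sub_self]
    exact tendsto_const_nhds
  have hidn : ∃ (C R₀ T : ℝ) (ζ : ℝ → ℝ), Tendsto ζ atTop (𝓝 0) ∧
      S4SingleHole 2 (fun _ ↦ 1) binaryCentre binaryVel (3 / 4) binaryCharge C R₀ T ζ := by
    refine ⟨0, 1, 1, fun t ↦ 2 * |sepAD1 t|, ?_, ?_⟩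
    · simpa using (tendsto_sepAD1.abs.const_mul 2)
    · intro t i R ht hR _ hiso
      have key : ∀ {i j : Fin 2}, j ≠ i → (3 * R ≤ ‖binaryCentre i t - binaryCentre j t‖) →
          ‖binaryCentre i t - binaryCentre i t‖ ≤ R ∧ ¬ ‖binaryCentre j t - binaryCentre i t‖ ≤ R := by
        intro i j hji h3
        refine ⟨by simp; linarith, fun h' ↦ ?_⟩
        rw [norm_binaryCentre_sub hji] at h'
        rw [norm_binaryCentre_sub hji.symm] at h3
        linarith
      have hP : ∀ μ, binaryCharge t (binaryCentre i t) R μ = kinCharge t μ := by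
        intro μ
        unfold binaryCharge
        rw [if_neg]
        fin_cases i
        · obtain ⟨hn, hf⟩ := key (show (1 : Fin 2) ≠ 0 by decide) (hiso 1 (by decide))
          exact fun hh ↦ hf (hh.mp hn)
        · obtain ⟨hn, hf⟩ := key (show (0 : Fin 2) ≠ 1 by decide) (hiso 0 (by decide))
          exact fun hh ↦ hf (hh.mpr hn)
      obtain ⟨h0, hk⟩ := kinCharge_sub_binary_le i t
      refine ⟨?_, fun k ↦ ?_⟩
      · rw [hP, one_mul, zero_div, add_zero]; exact h0
      · rw [hP, one_mul, zero_div, add_zero]; exact hk k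
  have hwl : S4WindowLaw 2 binaryCentre (3 / 4) binaryCharge := by
    intro δ hδ hδ1
    refine ⟨1 / δ ^ 2, 1, 1, fun _ ↦ 0, tendsto_const_nhds, ?_⟩
    intro t₁ t₂ c R ht₁ h12 hlip hadm μ
    rw [add_zero]
    -- continuity and positivity of the radius along the path
    have hRcont : ContinuousOn R (Icc t₁ t₂) := by
      refine continuousOn_of_pathLipschitz (E := ℝ) fun s hs s' hs' ↦ ?_
      rw [Real.norm_eq_abs]; exact (hlip s hs s' hs').2
    have hRpos : ∀ s ∈ Icc t₁ t₂, 0 < R s := fun s hs ↦ one_pos.trans_le (hadm s hs).1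
    -- the budget integrand is continuous and nonnegative
    have hI2 : ContinuousOn (fun s ↦ ((R s) ^ 2)⁻¹) (Icc t₁ t₂) :=
      (hRcont.pow 2).inv₀ fun s hs ↦ (pow_pos (hRpos s hs) 2).ne'
    have hI74 : ContinuousOn (fun s ↦ ((R s) ^ (7 / 4 : ℝ))⁻¹) (Icc t₁ t₂) :=
      (hRcont.rpow_const fun s hs ↦ Or.inr (by norm_num)).inv₀ fun s hs ↦ (Real.rpow_pos_of_pos (hRpos s hs) _).ne'
    have hint2 : IntervalIntegrable (fun s ↦ ((R s) ^ 2)⁻¹) MeasureTheory.volume t₁ t₂ := by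
      refine ContinuousOn.intervalIntegrable ?_; rwa [uIcc_of_le h12]
    have hintB : IntervalIntegrable (fun s ↦ ((R s) ^ 2)⁻¹ + ((R s) ^ (7 / 4 : ℝ))⁻¹) MeasureTheory.volume t₁ t₂ := by
      refine ContinuousOn.intervalIntegrable ?_; rw [uIcc_of_le h12]; exact hI2.add hI74
    have hintInv : IntervalIntegrable (fun s : ℝ ↦ s⁻¹) MeasureTheory.volume t₁ t₂ := by
      refine ContinuousOn.intervalIntegrable ?_; rw [uIcc_of_le h12]
      exact continuousOn_id.inv₀ fun s hs ↦ (by linarith [hs.1] : (0 : ℝ) < s).ne'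
    have hBnonneg : 0 ≤ ∫ s in t₁..t₂, ((R s) ^ 2)⁻¹ + ((R s) ^ (7 / 4 : ℝ))⁻¹ :=
      intervalIntegral.integral_nonneg h12 fun s hs ↦
        add_nonneg (inv_nonneg.mpr (sq_nonneg _)) (inv_nonneg.mpr (Real.rpow_nonneg (hRpos s hs).le _))
    have h2leB : ∫ s in t₁..t₂, ((R s) ^ 2)⁻¹ ≤ ∫ s in t₁..t₂, (((R s) ^ 2)⁻¹ + ((R s) ^ (7 / 4 : ℝ))⁻¹) :=
      intervalIntegral.integral_mono_on h12 hint2 hintB fun s hs ↦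
        le_add_of_nonneg_right (inv_nonneg.mpr (Real.rpow_nonneg (hRpos s hs).le _))
    -- inside/outside status of each hole is constant along the path
    have hconst : ∀ (i : Fin 2), ∀ s ∈ Icc t₁ t₂,
        (‖binaryCentre i t₁ - c t₁‖ ≤ R t₁ ↔ ‖binaryCentre i s - c s‖ ≤ R s) := by
      intro i s hs
      have hsub : Icc t₁ s ⊆ Icc t₁ t₂ := Icc_subset_Icc le_rfl hs.2
      exact inside_iff_inside_of_admissible (continuous_binaryCentre i) hδ one_pos hs.1
        (fun u hu u' hu' ↦ hlip u (hsub hu) u' (hsub hu')) fun u hu ↦ ⟨(hadm u (hsub hu)).1, (hadm u (hsub hu)).2.2 i⟩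
    have ht₂ : t₂ ∈ Icc t₁ t₂ := right_mem_Icc.mpr h12
    by_cases hiff : (‖binaryCentre 0 t₁ - c t₁‖ ≤ R t₁ ↔ ‖binaryCentre 1 t₁ - c t₁‖ ≤ R t₁)
    · -- both holes inside or both outside, at `t₁` hence at `t₂`: the charge is `0` at both ends
      have hiff2 : (‖binaryCentre 0 t₂ - c t₂‖ ≤ R t₂ ↔ ‖binaryCentre 1 t₂ - c t₂‖ ≤ R t₂) := by
        rw [← hconst 0 t₂ ht₂, ← hconst 1 t₂ ht₂]; exact hiff
      simp only [binaryCharge, if_pos hiff, if_pos hiff2, sub_self, abs_zero]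
      positivity
    · -- exactly one hole inside along the whole path: the charge is `kinCharge` at both ends
      have hiff2 : ¬ (‖binaryCentre 0 t₂ - c t₂‖ ≤ R t₂ ↔ ‖binaryCentre 1 t₂ - c t₂‖ ≤ R t₂) := by
        rw [← hconst 0 t₂ ht₂, ← hconst 1 t₂ ht₂]; exact hiff
      simp only [binaryCharge, if_neg hiff, if_neg hiff2]
      -- the radius is at most `d/(2δ)` along the path, so `1/s ≤ (3/(4δ²)) R(s)⁻²`
      have hrate : ∀ s ∈ Icc t₁ t₂, s⁻¹ ≤ 3 / (4 * δ ^ 2) * ((R s) ^ 2)⁻¹ := by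
        intro s hs
        have hs1 : 1 ≤ s := ht₁.trans hs.1
        have hs0 : (0 : ℝ) < s := by linarith
        have hRs := hRpos s hs
        have hone : ¬ (‖binaryCentre 0 s - c s‖ ≤ R s ↔ ‖binaryCentre 1 s - c s‖ ≤ R s) := by
          rw [← hconst 0 s hs, ← hconst 1 s hs]; exact hiff
        have hgeo : 2 * δ * R s ≤ sepA s := by
          have had0 := (hadm s hs).2.2 0
          have had1 := (hadm s hs).2.2 1
          by_cases hin0 : ‖binaryCentre 0 s - c s‖ ≤ R s
          · have hout1 : ¬ ‖binaryCentre 1 s - c s‖ ≤ R s := fun h1 ↦ hone ⟨fun _ ↦ h1, fun _ ↦ hin0⟩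
            rw [← norm_binaryCentre_sub (show (0 : Fin 2) ≠ 1 by decide) s]
            exact two_mul_delta_mul_le_norm_sub hRs hδ had0 had1 hin0 hout1
          · have hin1 : ‖binaryCentre 1 s - c s‖ ≤ R s := by
              by_contra hout1; exact hone ⟨fun h0 ↦ absurd h0 hin0, fun h1 ↦ absurd h1 hout1⟩
            rw [← norm_binaryCentre_sub (show (1 : Fin 2) ≠ 0 by decide) s]
            exact two_mul_delta_mul_le_norm_sub hRs hδ had1 had0 hin1 hin0
        have hsq : 4 * δ ^ 2 * (R s) ^ 2 ≤ 3 * s := by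
          calc 4 * δ ^ 2 * (R s) ^ 2 = (2 * δ * R s) ^ 2 := by ring
            _ ≤ sepA s ^ 2 := pow_le_pow_left₀ (by positivity) hgeo 2
            _ ≤ 2 + s := sepA_sq_le hs0.le
            _ ≤ 3 * s := by linarith
        have hpos' : 0 < 4 * δ ^ 2 * (R s) ^ 2 := by positivity
        rw [show 3 / (4 * δ ^ 2) * ((R s) ^ 2)⁻¹ = 3 / (4 * δ ^ 2 * (R s) ^ 2) by field_simp,
          le_div_iff₀ hpos', inv_mul_le_iff₀ hs0]
        linarith
      calc |kinCharge t₂ μ - kinCharge t₁ μ| ≤ |vel t₂ - vel t₁| / 2 := abs_kinCharge_sub_le t₁ t₂ μ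
        _ ≤ (∫ s in t₁..t₂, s⁻¹) / 2 := by gcongr; exact abs_vel_sub_vel_le ht₁ h12
        _ ≤ (∫ s in t₁..t₂, 3 / (4 * δ ^ 2) * ((R s) ^ 2)⁻¹) / 2 := by
            gcongr
            exact intervalIntegral.integral_mono_on h12 hintInv (hint2.const_mul _) hrate
        _ = 3 / (8 * δ ^ 2) * ∫ s in t₁..t₂, ((R s) ^ 2)⁻¹ := by
            rw [intervalIntegral.integral_const_mul]; ring
        _ ≤ 3 / (8 * δ ^ 2) * ∫ s in t₁..t₂, (((R s) ^ 2)⁻¹ + ((R s) ^ (7 / 4 : ℝ))⁻¹) :=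
            mul_le_mul_of_nonneg_left h2leB (by positivity)
        _ ≤ 1 / δ ^ 2 * ∫ s in t₁..t₂, (((R s) ^ 2)⁻¹ + ((R s) ^ (7 / 4 : ℝ))⁻¹) := by
            refine mul_le_mul_of_nonneg_right ?_ hBnonneg
            rw [show 3 / (8 * δ ^ 2) = (3 / 8) / δ ^ 2 by ring]
            exact div_le_div_of_nonneg_right (by norm_num) (by positivity)
  -- the model satisfies every remaining clause, yet hole `0` has no Cesàro velocity
  have hconc := h 2 (fun _ ↦ 1) binaryCentre binaryVel (3 / 4) binaryCharge (fun _ ↦ one_pos) (by norm_num)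
    (by norm_num) contDiff_binaryCentre eventually_norm_binaryCentre_le hsep continuous_binaryVel
    ⟨1 / 2, by norm_num, by norm_num, fun i ↦ Eventually.of_forall (norm_binaryVel_le i)⟩ hslav hwl hidn
  obtain ⟨V, hV⟩ := hconc 0
  refine not_tendsto_centre_div (by norm_num : (1 / 4 : ℝ) ≠ 0) ⟨V 0, ?_⟩
  have hc := ((EuclideanSpace.proj (0 : Fin 3)).continuous.tendsto V).comp hV
  refine hc.congr fun t ↦ ?_
  simp [binaryCentre, axisCentre, div_eq_inv_mul]

end Summit.FinalStateConjecture.FinalStateConjecture.Theorems.InertialRecession.Negative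

end
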